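/-
Copyright (c) 2026 the pub-hodgecm-mathlib formalisation cell (harness21).  Prover seat hodgecm-mathlib-K2E3-p11 (g4),
Track B «K2-LIT» ∕ h413 (`stmt-HodgeConjecture-24833`), line `K2_E3_EllipticInputs`, unit U12 §L, kernel road «RICHARDSON» for (L-B_GL)
(`sig_K2E3GLnNilpotentFourierRegular`), brick (R2), group side: THE RICHARDSON UNIPOTENT AVERAGE `Λ_c(f) = ∫_{K×U_c} f(k u k⁻¹)` OF `GL_n(F)` IS
INVARIANT UNDER CONJUGATION — every two-block parabolic `P_c`, every `n`.  2026-09-04.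
-/
import Literature.NumberTheory.Automorphic.GLnBlockScalarOrbitalIntegral      -- ★ `exists_integral_descConj_blockScalar_eq_smul` (Rogawski L. 4.13.1: `O_z(f) = C w(z) Λ_c^z(f)` at a block scalar `z`)
import Literature.NumberTheory.Automorphic.GLnStandardLeviUnimodular         -- ★ `isInvInvariant_haar_standardLeviGL`, `isClosed_standardLeviGL`, `TateLocalZetaShells`
import Literature.NumberTheory.Automorphic.GLnGelfandKazhdanInvolution       -- ★ `t2Space_generalLinearGroup`, `locallyCompactSpace_generalLinearGroup`
import Literature.NumberTheory.Automorphic.OrbitalIntegralSupportLocalisation -- ★ `isLocSmooth_comp_conj`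
import Literature.NumberTheory.Automorphic.ParabolicSemidirect               -- ★ `continuous_blockDiagonalGL`
import Literature.MeasureTheory.Group.InvariantQuotientExistence             -- ★ `exists_smulInvariantMeasure_integral_fiberIntegral_eq` (invariant Radon measure on `G ⧸ M_c`)
import Literature.Topology.LocallyConstantCompactSupportUniform              -- ★ `exists_nhds_one_forall_mul_eq_of_hasCompactSupport`
import HarnessLib

/-!
# K2_E3 road (h413), §L — kernel road «RICHARDSON» for (L-B_GL), brick (R2), group side:
# the unipotent average `Λ_c(f) = ∫_{GL_n(𝒪) × U_c} f(k u k⁻¹) d(κ ⊗ μ_U)` is `Ad(GL_n(F))`-invariant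

Cell `pub/hodgecm-mathlib` (D-0151), Track B (21-frontier RULING «PUSH BOTH» 2026-09-03, director req624), seat K2E3-p11 (g4); dealer K2E3-plan (g3) «=»
2026-09-04T04:11Z «(D57) re-pointed … p11 keeps (R2)».  `--supports stmt-HodgeConjecture-24833 --as helper`; THEOREMS ONLY (no definition ∕ instance ∕ notation ∕
named fact ∕ `sorry`); never imports `Cruxes/…/Lines`.  COUNT-NEUTRAL: (L-B_GL) and its leaves stay OPEN.  This is the `GL_n`, two-block twin of the §L lead's
★ `K2E3GL2UnipotentAverageConjInvariant.GL2.unipotentAverage_comp_conj_eq` (the case `n = 2`, `P = B`), by the SAME road (no Iwasawa cocycle): the invariance is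
inherited from the orbital integrals of the `(G, M_c)`-regular BLOCK SCALARS `z_t = diag(t₀ 1_I, t₁ 1_J)` through Rogawski's descent formula, which is ★ for every
two-block parabolic of `GL_n` (`GLnBlockScalarOrbitalIntegral`).

THE MATHEMATICS.  `G = GL_n(F)`, `F` non-archimedean local, `c : Fin n → Bool` monotone (the standard two-block parabolic `P_c = M_c U_c`), `K = GL_n(𝒪)`, Haar
measures `κ` on `K`, `μ_U` on `U_c`.  For `f ∈ C_c^∞(G)` put `Λ(f) := ∫_{K × U_c} f(k u k⁻¹)`.  CLAIM (**`GLn.unipotentAverage_comp_conj_eq`**): `Λ(f ∘ Ad x) = Λ(f)` for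
every `x ∈ G`.  PROOF: (§1) `f` and `f ∘ Ad x` are right-invariant under a neighbourhood `V` of `1` (★ uniform local constancy); by the tube lemma over the compact
`K` there is `W ∈ 𝓝 1` with `k W k⁻¹ ⊆ V` for all `k ∈ K` (`exists_nhds_one_forall_conj_mem`), and `W` contains a block scalar `z = z_t` with `t₀ ≠ t₁`
(`exists_blockScalar_ne_mem`: `t = (1, 1 + a)`, `‖a‖ = q^{-r}` small).  (§2) For such `z`, `f(k (u z) k⁻¹) = f((k u k⁻¹)(k z k⁻¹)) = f(k u k⁻¹)`, so the average at
`z` equals `Λ` (`unipotentAverage_at_eq`).  (§3) ★ Rogawski's descent at the `M_c`-central regular `z` (`A = M_c = C_G(z)`, `μ_q` an invariant Radon measure on `G ⧸ A`,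
★ existence since `M_c` is unimodular): `∫_{G⧸A} f(y z y⁻¹) dμ_q = C ‖1 − t₀/t₁‖^{-|I||J|} ∫_{K×U_c} f(k (u z) k⁻¹)` with ONE `C ≠ 0`; the left side is conjugation
invariant (the integrand of `f ∘ Ad x` is the `x`-translate, `μ_q` is invariant), hence so is the right side, hence so is `Λ`.
* §1 `exists_nhds_one_forall_conj_mem` (generic topological groups), `exists_blockScalar_ne_mem`.
* §2 `unipotentAverage_at_eq` — `∫ f(k (u z) k⁻¹) = ∫ f(k u k⁻¹)` once `k z k⁻¹` lies in the right-invariance neighbourhood of `f` for all `k ∈ K`.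
* §3 **`GLn.unipotentAverage_comp_conj_eq`**.
The Lie-algebra form (the Richardson measure `Λ_P(f) = ∫_K ∫_{𝔫_c} f(Ad(k) Y)` on `𝔤𝔩_n(F)` is `Ad`-invariant) is the sequel: `k (1 + Y) k⁻¹ − 1 = Ad(k) Y` and an
`Ad`-invariant clopen cut-off `{X | charpoly X ≡ tⁿ mod 𝔭} ⊇ 𝒩` (the §L lead's `𝔤𝔩₂` dictionary ★ p856734 `nilpotentAverage_conj`).

References: [Rogawski1990] J. D. Rogawski, *Automorphic Representations of Unitary Groups in Three Variables* (1990), §4.13 Lemma 4.13.1 (a) and proof p. 70;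
§8.1 p. 112 · [HarishChandra1999AdmissibleDistributions] Harish-Chandra (DeBacker–Sally), *Admissible invariant distributions on reductive p-adic groups* (1999), §3
(Deligne–Rao: the nilpotent ∕ unipotent orbital integrals are invariant Radon measures), Thm. 4.4 · [BernsteinZelevinsky1976] §1.1 (uniform local constancy).
HONEST LABEL: HC_CM is proved only modulo the 7 printed citations (2 remaining named inputs: hLiu418 = stmt-HodgeConjecture-24832, h413 = stmt-HodgeConjecture-24833)
until rung 0 closes; count-neutral helper.
-/

set_option autoImplicit false
set_option linter.dupNamespace false   -- `Summit.HodgeConjecture.HodgeConjecture.…` (D-0017 nested layout; lakefile exemption for Summits)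

noncomputable section

open MeasureTheory MeasureTheory.Measure Filter Topology Set
open scoped MatrixGroups NNReal ENNReal
open Literature.NumberTheory.Automorphic Literature.NumberTheory.Rogawski1990 Literature.MeasureTheory.Group Literature.Topology
open Literature.NumberTheory.GaloisRepresentations Literature.NumberTheory.GaloisRepresentations.IsNonarchimedeanLocalField

namespace Summit.HodgeConjecture.HodgeConjecture.Cruxes.H413.K2E3GLnRichardsonMeasureAdInvariant

/-! ## §1  The tube lemma over a compact set, and regular block scalars near `1` -/

section Tube

variable {G : Type*} [Group G] [TopologicalSpace G] [IsTopologicalGroup G]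

/-- **Tube lemma for conjugation**: for a compact `K ⊆ G` and a neighbourhood `V` of `1`, there is a neighbourhood `W` of `1` with `k z k⁻¹ ∈ V` for all
`z ∈ W`, `k ∈ K` (the agreement set `{(k, z) | k z k⁻¹ ∈ V°}` is open and contains `K × {1}`). [folklore] -/
theorem exists_nhds_one_forall_conj_mem {K : Set G} (hK : IsCompact K) {V : Set G} (hV : V ∈ 𝓝 (1 : G)) :
    ∃ W ∈ 𝓝 (1 : G), ∀ z ∈ W, ∀ k ∈ K, k * z * k⁻¹ ∈ V := by
  have hA : IsOpen {p : G × G | p.1 * p.2 * p.1⁻¹ ∈ interior V} :=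
    isOpen_interior.preimage ((continuous_fst.mul continuous_snd).mul continuous_fst.inv)
  have hsub : K ×ˢ ({1} : Set G) ⊆ {p : G × G | p.1 * p.2 * p.1⁻¹ ∈ interior V} := by
    rintro ⟨k, z⟩ ⟨-, hz⟩
    rw [Set.mem_singleton_iff] at hz
    subst hz
    show k * 1 * k⁻¹ ∈ interior V
    rw [mul_one, mul_inv_cancel]
    exact mem_interior_iff_mem_nhds.2 hV
  obtain ⟨U₁, W, -, hWo, hKU, h1W, hUW⟩ := generalized_tube_lemma hK isCompact_singleton hA hsub
  refine ⟨W, hWo.mem_nhds (h1W (Set.mem_singleton 1)), fun z hz k hk => ?_⟩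
  exact interior_subset (hUW (Set.mk_mem_prod (hKU hk) hz) : (k, z) ∈ {p : G × G | p.1 * p.2 * p.1⁻¹ ∈ interior V})

end Tube

section BlockScalar

variable {F : Type*} [Field F] [TopologicalSpace F] {n : ℕ} (c : Fin n → Bool)

/-- The block-scalar family `m ↦ z_{(1, m)} = diag(1_I, m 1_J)` is continuous `Fˣ → GL_n(F)` and sends `1 ↦ 1`. [folklore] -/
theorem continuous_blockScalar_and_map_one [IsTopologicalRing F] :
    Continuous (fun m : Fˣ => blockDiagonalGL F c fun a => Matrix.GeneralLinearGroup.scalar {i // c i = a} (cond a m 1)) ∧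
      (blockDiagonalGL F c fun a => Matrix.GeneralLinearGroup.scalar {i // c i = a} (cond a (1 : Fˣ) 1)) = 1 := by
  refine ⟨(continuous_blockDiagonalGL (R := F) (c := c)).comp (continuous_pi fun a => ?_), ?_⟩
  · -- continuity of `m ↦ scalar (cond a m 1)` into the units of the block (`scalar = Units.map (Matrix.scalar _)`)
    have hsc : Continuous fun m : Fˣ => Matrix.GeneralLinearGroup.scalar {i // c i = a} m := by
      change Continuous fun m : Fˣ => Units.map ((Matrix.scalar {i // c i = a}).toMonoidHom) m
      refine Continuous.units_map _ ?_
      change Continuous fun r : F => Matrix.scalar {i // c i = a} r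
      simp only [Matrix.scalar_apply]
      exact (continuous_pi fun _ => continuous_id).matrix_diagonal
    cases a
    · simpa using continuous_const
    · simpa using hsc
  · have : (fun a : Bool => Matrix.GeneralLinearGroup.scalar {i // c i = a} (cond a (1 : Fˣ) 1)) = 1 := by
      funext a; cases a <;> simp
    rw [this, map_one]

/-- **Regular block scalars near `1`**: every neighbourhood of `1 ∈ GL_n(F)` contains a block scalar `z_t = diag(t₀ 1_I, t₁ 1_J)` with `t₀ ≠ t₁`
(`t = (1, 1 + a)`, `0 < ‖a‖ = q^{-r}` small; ★ `exists_unitFiltration_subset`, ★ `exists_normAbs_eq_inv_zpow_of_int`). [cite: Rogawski1990, §8.1 p. 112] -/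
theorem exists_blockScalar_ne_mem [ValuativeRel F] [IsNonarchimedeanLocalField F] {W : Set (GL (Fin n) F)} (hW : W ∈ 𝓝 (1 : GL (Fin n) F)) :
    ∃ t : Bool → Fˣ, (t false : F) ≠ t true ∧
      (blockDiagonalGL F c fun a => Matrix.GeneralLinearGroup.scalar {i // c i = a} (t a)) ∈ W := by
  haveI : IsTopologicalRing F := inferInstance
  obtain ⟨hcont, h1⟩ := continuous_blockScalar_and_map_one (F := F) c
  have hW' : (fun m : Fˣ => blockDiagonalGL F c fun a => Matrix.GeneralLinearGroup.scalar {i // c i = a} (cond a m 1)) ⁻¹' W ∈ 𝓝 (1 : Fˣ) := by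
    refine hcont.continuousAt.preimage_mem_nhds ?_
    rw [h1]
    exact hW
  obtain ⟨r, hr, hsub⟩ := exists_unitFiltration_subset hW'
  obtain ⟨a, ha0, ha⟩ := exists_normAbs_eq_inv_zpow_of_int (F := F) (r : ℤ)
  have hlt : normAbs F a < 1 := by
    rw [ha, zpow_natCast]
    exact pow_lt_one₀ inv_residueFieldCard_pos.le inv_residueFieldCard_lt_one (by omega)
  have h1a : (1 : F) + a ≠ 0 := by
    intro h
    have : a = -1 := by linear_combination h
    rw [this, normAbs_neg, map_one] at hlt
    exact lt_irrefl _ hlt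
  refine ⟨fun b => cond b (Units.mk0 (1 + a) h1a) 1, ?_, hsub ((mem_unitFiltration_iff_sub_one_mem hr _).2 ?_)⟩
  · simp only [cond_false, cond_true, Units.val_one, Units.val_mk0]
    intro h
    exact ha0 (by linear_combination -h)
  · rw [Units.val_mk0, add_sub_cancel_left, mem_primePowBall_iff, ha]

end BlockScalar

/-! ## §2  The average at a block scalar close to `1` equals the average at `1` -/

section Average

variable {F : Type*} [Field F] [ValuativeRel F] [TopologicalSpace F] [IsNonarchimedeanLocalField F]
  {n : ℕ} {c : Fin n → Bool} [MeasurableSpace (GL (Fin n) F)]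
  {E : Type*} [NormedAddCommGroup E] [NormedSpace ℝ E]

omit [TopologicalSpace F] [IsNonarchimedeanLocalField F] in
/-- **`∫_{K×U} f(k (u z) k⁻¹) = ∫_{K×U} f(k u k⁻¹)`** as soon as `f (g v) = f g` for all `g` and all `v` in a set `V` with `k z k⁻¹ ∈ V` for every `k ∈ K`:
`k (u z) k⁻¹ = (k u k⁻¹)(k z k⁻¹)`. [cite: Rogawski1990, §8.1 p. 112] -/
theorem unipotentAverage_at_eq (κ : Measure ↥(glInt n F)) (μN : Measure ↥(unipotentRadicalGL F c))
    {f : GL (Fin n) F → E} {V : Set (GL (Fin n) F)} (hfV : ∀ g, ∀ v ∈ V, f (g * v) = f g)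
    {z : GL (Fin n) F} (hz : ∀ k : GL (Fin n) F, k ∈ glInt n F → k * z * k⁻¹ ∈ V) :
    ∫ q : ↥(glInt n F) × ↥(unipotentRadicalGL F c), f ((q.1 : GL (Fin n) F) * ((q.2 : GL (Fin n) F) * z) * (q.1 : GL (Fin n) F)⁻¹) ∂(κ.prod μN) =
      ∫ q : ↥(glInt n F) × ↥(unipotentRadicalGL F c), f ((q.1 : GL (Fin n) F) * (q.2 : GL (Fin n) F) * (q.1 : GL (Fin n) F)⁻¹) ∂(κ.prod μN) := by
  refine integral_congr_ae (Eventually.of_forall fun q => ?_)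
  have h : (q.1 : GL (Fin n) F) * ((q.2 : GL (Fin n) F) * z) * (q.1 : GL (Fin n) F)⁻¹ =
      ((q.1 : GL (Fin n) F) * (q.2 : GL (Fin n) F) * (q.1 : GL (Fin n) F)⁻¹) * ((q.1 : GL (Fin n) F) * z * (q.1 : GL (Fin n) F)⁻¹) := by group
  simp only [h]
  exact hfV _ _ (hz _ q.1.2)

end Average

/-! ## §3  The Richardson unipotent average is conjugation invariant -/

section Main

variable {F : Type*} [Field F] [ValuativeRel F] [TopologicalSpace F] [IsNonarchimedeanLocalField F]
  [MeasurableSpace F] [BorelSpace F]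
  {n : ℕ} {c : Fin n → Bool} [MeasurableSpace (GL (Fin n) F)] [BorelSpace (GL (Fin n) F)]

/-- **(R2), GROUP SIDE: `Λ_c(f ∘ Ad x) = Λ_c(f)`.**  For a monotone two-block labelling `c` of `GL_n(F)` (`F` non-archimedean local), Haar measures `κ` on
`K = GL_n(𝒪)` and `μ_U` on the unipotent radical `U_c`, every locally constant compactly supported `f : GL_n(F) → ℂ` and every `x ∈ GL_n(F)`:
`∫_{K×U_c} f(x (k u k⁻¹) x⁻¹) d(κ ⊗ μ_U) = ∫_{K×U_c} f(k u k⁻¹) d(κ ⊗ μ_U)` — the Richardson (Deligne–Rao) unipotent orbital integral attached to `P_c` is an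
INVARIANT distribution.  Proof through ★ Rogawski's descent at a regular block scalar `z` close to `1` (§1–§2) and the conjugation invariance of the orbital
integral over `G ⧸ M_c` (★ invariant Radon measure, `M_c` unimodular).
[cite: Rogawski1990, §4.13 Lemma 4.13.1 (a), proof p. 70; §8.1 p. 112] [cite: HarishChandra1999AdmissibleDistributions, §3 p. 9] -/
theorem GLn.unipotentAverage_comp_conj_eq (hc : Monotone c)
    (κ : Measure ↥(glInt n F)) [IsHaarMeasure κ] (μN : Measure ↥(unipotentRadicalGL F c)) [IsHaarMeasure μN]
    {f : GL (Fin n) F → ℂ} (hlc : IsLocallyConstant f) (hcs : HasCompactSupport f) (x : GL (Fin n) F) :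
    ∫ q : ↥(glInt n F) × ↥(unipotentRadicalGL F c), f (x * ((q.1 : GL (Fin n) F) * (q.2 : GL (Fin n) F) * (q.1 : GL (Fin n) F)⁻¹) * x⁻¹) ∂(κ.prod μN) =
      ∫ q : ↥(glInt n F) × ↥(unipotentRadicalGL F c), f ((q.1 : GL (Fin n) F) * (q.2 : GL (Fin n) F) * (q.1 : GL (Fin n) F)⁻¹) ∂(κ.prod μN) := by
  classical
  haveI : T2Space F := (isLocalField F).toT2Space
  haveI : LocallyCompactSpace F := (isLocalField F).toLocallyCompactSpace
  haveI : SecondCountableTopology F := secondCountableTopology_localField F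
  haveI : T2Space (GL (Fin n) F) := t2Space_generalLinearGroup F n
  haveI : LocallyCompactSpace (GL (Fin n) F) := locallyCompactSpace_generalLinearGroup F n
  haveI : SecondCountableTopology (GL (Fin n) F) := by
    haveI : SecondCountableTopology (Matrix (Fin n) (Fin n) F) := inferInstanceAs (SecondCountableTopology (Fin n → Fin n → F))
    haveI : SecondCountableTopology (Matrix (Fin n) (Fin n) F)ᵐᵒᵖ := MulOpposite.opHomeomorph.symm.secondCountableTopology
    exact Units.isEmbedding_embedProduct.secondCountableTopology
  -- `f ∘ Ad x` is again locally constant with compact support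
  set f' : GL (Fin n) F → ℂ := fun g => f (x * g * x⁻¹) with hf'
  have hsm' : IsLocSmooth f' := isLocSmooth_comp_conj (⟨hlc, hcs⟩ : IsLocSmooth f) x
  -- §1: a common right-invariance neighbourhood `V`, the tube `W`, a regular block scalar `z ∈ W`
  obtain ⟨V₁, hV₁, hfV₁⟩ := exists_nhds_one_forall_mul_eq_of_hasCompactSupport hlc hcs
  obtain ⟨V₂, hV₂, hfV₂⟩ := exists_nhds_one_forall_mul_eq_of_hasCompactSupport hsm'.1 hsm'.2
  obtain ⟨W, hW, hWV⟩ := exists_nhds_one_forall_conj_mem (G := GL (Fin n) F) (isCompact_glInt n F) (Filter.inter_mem hV₁ hV₂)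
  obtain ⟨t, ht, hzW⟩ := exists_blockScalar_ne_mem (F := F) c hW
  set z : GL (Fin n) F := blockDiagonalGL F c fun a => Matrix.GeneralLinearGroup.scalar {i // c i = a} (t a) with hz
  have hz₁ : ∀ k : GL (Fin n) F, k ∈ glInt n F → k * z * k⁻¹ ∈ V₁ := fun k hk => (hWV z hzW k hk).1
  have hz₂ : ∀ k : GL (Fin n) F, k ∈ glInt n F → k * z * k⁻¹ ∈ V₂ := fun k hk => (hWV z hzW k hk).2
  -- `A = M_c = C_G(z)`, an invariant Radon measure on `G ⧸ A`
  set A : Subgroup (GL (Fin n) F) := standardLeviGL F c with hA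
  have hAcl : IsClosed ((A : Subgroup (GL (Fin n) F)) : Set (GL (Fin n) F)) := isClosed_standardLeviGL (R := F) c
  letI : MeasurableSpace (GL (Fin n) F ⧸ A) := borel _
  haveI : BorelSpace (GL (Fin n) F ⧸ A) := ⟨rfl⟩
  haveI : BorelSpace ↥A := Subtype.borelSpace _
  haveI : LocallyCompactSpace ↥A := hAcl.locallyCompactSpace
  haveI : SecondCountableTopology ↥A := TopologicalSpace.Subtype.secondCountableTopology _
  haveI : (haar : Measure ↥A).IsInvInvariant := isInvInvariant_haar_standardLeviGL F c haar
  haveI : (haar : Measure (GL (Fin n) F)).IsMulRightInvariant := isMulRightInvariant_generalLinearGroup _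
  obtain ⟨μq, hμinv, hμreg, hμ0, -⟩ :=
    exists_smulInvariantMeasure_integral_fiberIntegral_eq A (haar : Measure ↥A) hAcl (haar : Measure (GL (Fin n) F))
  haveI := hμinv
  haveI := hμreg
  -- the block scalar `z` is centralised by `A`
  have hcentral : Subgroup.centralizer ({z} : Set (GL (Fin n) F)) = A := by
    rw [hz, hA]
    exact centralizer_blockDiagonalGL_scalar_eq_standardLeviGL (R := F) c t fun a b hab => by
      refine (sub_ne_zero.2 fun h => ?_).isUnit
      cases a <;> cases b
      · exact hab rfl
      · exact ht h
      · exact ht h.symm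
      · exact hab rfl
  have hzA : ∀ a ∈ A, a * z = z * a := fun a ha => by
    rw [← hcentral] at ha
    exact Subgroup.mem_centralizer_singleton_iff.1 ha
  -- §3: Rogawski's descent at `z`, for `f` and for `f'`
  obtain ⟨C, hC0, hC⟩ := exists_integral_descConj_blockScalar_eq_smul F hc (A := A) hA μq hμ0 κ μN (E := ℂ)
  have e1 := hC t ht hzA f hlc.continuous
  have e2 := hC t ht hzA f' hsm'.1.continuous
  -- conjugation invariance of the orbital integral over `G ⧸ A`
  have hinv : ∫ y, descConj z A hzA f' y ∂μq = ∫ y, descConj z A hzA f y ∂μq := by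
    have h1 : ∀ y, descConj z A hzA f' y = descConj z A hzA f (x • y) := fun y => by
      induction y using QuotientGroup.induction_on with
      | H g =>
        rw [MulAction.Quotient.smul_mk, descConj_mk, descConj_mk, smul_eq_mul]
        simp only [hf']
        congr 1
        group
    simp_rw [h1]
    exact integral_smul_eq_self _
  rw [e1, e2] at hinv
  -- §2: both averages at `z` are the averages at `1`
  rw [unipotentAverage_at_eq κ μN hfV₂ hz₂, unipotentAverage_at_eq κ μN hfV₁ hz₁] at hinv
  -- cancel the non-zero scalar `C · ‖1 − t₀/t₁‖^{-|I||J|}`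
  have key : ∀ {r : ℝ} {a b : ℂ}, r • a = r • b → r ≠ 0 → a = b := fun h hr => smul_right_injective ℂ hr h
  have htu : ((t true : Fˣ) : F) ≠ 0 := Units.ne_zero _
  have hcancel := key hinv (by
    rw [NNReal.coe_ne_zero]
    refine mul_ne_zero hC0 ((map_ne_zero (normAbs F)).2 (inv_ne_zero (pow_ne_zero _ fun h1 => ht ?_)))
    rw [sub_eq_zero] at h1
    -- `1 = t₀ · t₁⁻¹` ⇒ `t₀ = t₁`
    have h2 := congrArg (fun y : F => y * ((t true : Fˣ) : F)) h1
    simp only [one_mul, inv_mul_cancel_right₀ htu] at h2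
    exact h2.symm)
  simpa only [hf', Matrix.mul_assoc] using hcancel

end Main

end Summit.HodgeConjecture.HodgeConjecture.Cruxes.H413.K2E3GLnRichardsonMeasureAdInvariant

end
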